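import Summits.RiemannHypothesis.RiemannHypothesis.Theorems.Splittings.LinearRayOnePointDefs
import Summits.RiemannHypothesis.RiemannHypothesis.Theorems.UniversalFactorMediumUCells
import Summits.RiemannHypothesis.RiemannHypothesis.Theorems.UniversalFactorMediumUTables
import Summits.RiemannHypothesis.RiemannHypothesis.Theorems.UniversalFactorMediumKernelNoGoStubQuadH
import Summits.RiemannHypothesis.RiemannHypothesis.Theorems.UniversalFactorMediumKernelNoGoStubPhiPartialC
import Summits.RiemannHypothesis.RiemannHypothesis.Theorems.UniversalFactorMediumKernelNoGoStubPhiTailN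
import Literature.NumberTheory.LFunctions.XiMoments

/-!
# Soundness of the u-side evaluator of `H_0′`, I: cell sums, outer loop, one u-cell (cell rh-split, C15 / S-dbn-1)

Soundness, part I, of the certified u-side evaluator `evalH0D` of `Re H_0′(x′) = −∫₀^∞ Φ(u) u sin(x′u) du`
(`Theorems/Splittings/LinearRayOnePointDefs.lean`), mirroring `UniversalFactorMediumUCells/UEval.lean` of the
medium-kernel engine with the extra factor `u` and sines instead of cosines:
* `cellZD_inv`, `cellsLoopD_inv` — the loop invariants (`∋ Σ_j ρW_jΦ_N(u_{cj}) u_{cj} e^{i x′ ρ t_j}`, `∋ Σ_c GLD_c`);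
* `cellD_gl_error` (disc bound `PhiMaj·(uc + R)·e^{x′R}` in `UniversalFactor.stub_quadH`), `cellD_tail_error`
  (`2ρ(uc + ρ)T_N(uc − ρ)`), `cellD_error` (total, bounded uniformly in the cell index by `U = 2Cuρ`);
* `continuousOn_/integrableOn_phi_mul_id_mul_sin` — the real derivative integrand.
HONEST LABEL: machinery refuting an RH-STRENGTHENING conjunct (the linear-factor ray of
`Literature/Barriers/RiemannHypothesis/NewmanConjecture.lean`); RH-free; nothing here bears on the truth of RH.
Provenance: rh-splitx-eng-5 g3 (cell rh-split, D-0116 arm; C15 / S-dbn-1 filler → kernel), monolith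
`HOME/rh-splitx-eng-5/ray/LinearRayOnePointMono.lean`.
-/

set_option linter.dupNamespace false

noncomputable section

namespace Summit.RiemannHypothesis.RiemannHypothesis.Theorems.Splittings.LinearRayOnePoint

open MeasureTheory Set
open Literature.NumberTheory.LFunctions
open Literature.Analysis.ValidatedNumerics Literature.Analysis.ValidatedNumerics.NumericsMP
open Summit.RiemannHypothesis.RiemannHypothesis.Theorems

/-! ## The cell sums and the outer loop -/

/-- The u-weighted node sum of a cell encloses `z + Σ_{j<n} ρW_jΦ_N(u_{cj}) u_{cj} e^{i x' ρ t_j}`. [folklore] -/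
theorem cellZD_inv {C : UniversalFactor.OsaCtx} (hV : C.Valid) {x' : ℝ} {NF : Array MC}
    (hNF : ∀ j < 32, MC.mem C.S (Complex.exp (((x' * C.rho * UniversalFactor.osaNodeR j : ℝ) : ℂ) * Complex.I))
      (NF.getD j (MC.ofInt C.S 0)))
    {c : ℕ} (hc : c < C.Cu) :
    ∀ (n : ℕ), n ≤ 32 → ∀ {acc : MC} {z : ℂ}, MC.mem C.S z acc →
      MC.mem C.S (z + ∑ j ∈ Finset.range n,
        ((C.rho * UniversalFactor.osaWeightR j *
            UniversalFactor.osaPhiN C.Nth ((2 * c + 1) * C.rho + C.rho * UniversalFactor.osaNodeR j) *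
            ((2 * c + 1) * C.rho + C.rho * UniversalFactor.osaNodeR j) : ℝ) : ℂ) *
          Complex.exp (((x' * C.rho * UniversalFactor.osaNodeR j : ℝ) : ℂ) * Complex.I))
        (cellZD C NF c n acc)
  | 0, _, acc, z, hz => by simpa [cellZD] using hz
  | n + 1, hn, acc, z, hz => by
      simp only [cellZD]
      have ht := hV.htab c n hc (by omega)
      have hN := hNF n (by omega)
      have hu : MI.mem C.S ((2 * c + 1) * C.rho + C.rho * UniversalFactor.osaNodeR n)
          (MI.ofFrac C.S (uNodeQ C c n).num (uNodeQ C c n).den) := by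
        have := UniversalFactor.osa_mem_ofFracQ C.S (uNodeQ C c n)
        rw [uNodeQ_cast C hV.hrhod] at this
        exact this
      have htu := MI.mem_mul hV.hS ht hu
      set r : ℝ := C.rho * UniversalFactor.osaWeightR n *
        UniversalFactor.osaPhiN C.Nth ((2 * c + 1) * C.rho + C.rho * UniversalFactor.osaNodeR n) *
        ((2 * c + 1) * C.rho + C.rho * UniversalFactor.osaNodeR n) with hr
      set w : ℂ := Complex.exp (((x' * C.rho * UniversalFactor.osaNodeR n : ℝ) : ℂ) * Complex.I) with hw
      set tu : MI := MI.mul C.S (C.phiTab.getD (c * 32 + n) (MI.ofInt C.S 0))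
        (MI.ofFrac C.S (uNodeQ C c n).num (uNodeQ C c n).den) with htu_def
      have hacc' : MC.mem C.S (z + (r : ℂ) * w)
          ⟨acc.re.add (MI.mul C.S tu (NF.getD n (MC.ofInt C.S 0)).re),
           acc.im.add (MI.mul C.S tu (NF.getD n (MC.ofInt C.S 0)).im)⟩ := by
        constructor
        · have := MI.mem_add hz.1 (MI.mem_mul hV.hS htu hN.1)
          refine UniversalFactor.osa_mem_congr this ?_
          simp [Complex.add_re, hr]
        · have := MI.mem_add hz.2 (MI.mem_mul hV.hS htu hN.2)
          refine UniversalFactor.osa_mem_congr this ?_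
          simp [Complex.add_im, hr]
      have := cellZD_inv hV hNF hc n (by omega) hacc'
      rw [Finset.sum_range_succ]
      convert this using 1
      rw [hr, hw]
      push_cast
      ring

/-- `Im(e^{i a} · r · e^{i b}) = r sin(a + b)`. [folklore] -/
theorem im_rot (a b r : ℝ) :
    (Complex.exp (((a : ℝ) : ℂ) * Complex.I) * (((r : ℝ) : ℂ) * Complex.exp (((b : ℝ) : ℂ) * Complex.I))).im =
      r * Real.sin (a + b) := by
  have : Complex.exp (((a : ℝ) : ℂ) * Complex.I) * (((r : ℝ) : ℂ) * Complex.exp (((b : ℝ) : ℂ) * Complex.I)) =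
      ((r : ℝ) : ℂ) * Complex.exp (((a + b : ℝ) : ℂ) * Complex.I) := by
    rw [show (((a + b : ℝ) : ℂ) * Complex.I) = ((a : ℝ) : ℂ) * Complex.I + ((b : ℝ) : ℂ) * Complex.I by push_cast; ring,
      Complex.exp_add]
    ring
  rw [this, Complex.im_ofReal_mul, Complex.exp_ofReal_mul_I_im]

/-- The outer loop encloses `r + Σ_{Cu−fuel ≤ c < Cu} glsD_c`. [folklore] -/
theorem cellsLoopD_inv {C : UniversalFactor.OsaCtx} (hV : C.Valid) {x' : ℝ} {NF : Array MC}
    (hNF : ∀ j < 32, MC.mem C.S (Complex.exp (((x' * C.rho * UniversalFactor.osaNodeR j : ℝ) : ℂ) * Complex.I))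
      (NF.getD j (MC.ofInt C.S 0)))
    {B2 : MC} (hB2 : MC.mem C.S (Complex.exp (((2 * x' * C.rho : ℝ) : ℂ) * Complex.I)) B2) :
    ∀ (fuel : ℕ), fuel ≤ C.Cu → ∀ {P : MC} {acc : MI} {r : ℝ},
      MC.mem C.S (Complex.exp (((x' * ((2 * ((C.Cu - fuel : ℕ) : ℝ) + 1) * C.rho) : ℝ) : ℂ) * Complex.I)) P →
      MI.mem C.S r acc →
      MI.mem C.S (r + ∑ c ∈ Finset.Ico (C.Cu - fuel) C.Cu, cellGLD C.Nth C.rho x' c)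
        (cellsLoopD C NF B2 fuel P acc)
  | 0, _, P, acc, r, _, hr => by simpa [cellsLoopD] using hr
  | fuel + 1, hfuel, P, acc, r, hP, hr => by
      simp only [cellsLoopD]
      set c : ℕ := C.Cu - (fuel + 1) with hcdef
      have hc : c < C.Cu := by omega
      have hZ := cellZD_inv hV hNF hc 32 le_rfl (MC.mem_ofInt C.S 0)
      simp only [Int.cast_zero, zero_add] at hZ
      set Zc : ℂ := ∑ j ∈ Finset.range 32, ((C.rho * UniversalFactor.osaWeightR j *
            UniversalFactor.osaPhiN C.Nth ((2 * c + 1) * C.rho + C.rho * UniversalFactor.osaNodeR j) *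
            ((2 * c + 1) * C.rho + C.rho * UniversalFactor.osaNodeR j) : ℝ) : ℂ) *
          Complex.exp (((x' * C.rho * UniversalFactor.osaNodeR j : ℝ) : ℂ) * Complex.I) with hZc
      set p : ℂ := Complex.exp (((x' * ((2 * (c : ℝ) + 1) * C.rho)) : ℂ) * Complex.I) with hp
      have hP' : MC.mem C.S p P := by rw [hp]; exact_mod_cast hP
      -- the imaginary part of p * Zc is the glsD sum of cell c
      have him : MI.mem C.S (cellGLD C.Nth C.rho x' c)
          ((MI.mul C.S P.re (cellZD C NF c 32 (MC.ofInt C.S 0)).im).add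
            (MI.mul C.S P.im (cellZD C NF c 32 (MC.ofInt C.S 0)).re)) := by
        have := MI.mem_add (MI.mem_mul hV.hS hP'.1 hZ.2) (MI.mem_mul hV.hS hP'.2 hZ.1)
        refine UniversalFactor.osa_mem_congr this ?_
        rw [show p.re * Zc.im + p.im * Zc.re = (p * Zc).im by rw [Complex.mul_im], hZc, Finset.mul_sum,
          Complex.im_sum, cellGLD]
        refine Finset.sum_congr rfl fun j _ => ?_
        rw [hp, show ((x' * ((2 * (c : ℝ) + 1) * C.rho) : ℂ)) = (((x' * ((2 * (c : ℝ) + 1) * C.rho) : ℝ)) : ℂ) by push_cast; rfl,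
          im_rot]
        ring_nf
      -- next rotation factor
      have hPB : MC.mem C.S (Complex.exp (((x' * ((2 * ((C.Cu - fuel : ℕ) : ℝ) + 1) * C.rho) : ℝ) : ℂ) * Complex.I))
          (MC.mul C.S P B2) := by
        have := MC.mem_mul hV.hS hP' hB2
        convert this using 2
        rw [hp, ← Complex.exp_add]
        congr 1
        have e : ((C.Cu - fuel : ℕ) : ℝ) = (c : ℝ) + 1 := by
          rw [show C.Cu - fuel = c + 1 by omega]; push_cast; rfl
        rw [e]; push_cast; ring
      have ih := cellsLoopD_inv hV hNF hB2 fuel (by omega) hPB (MI.mem_add hr him)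
      rw [Finset.sum_eq_sum_Ico_succ_bot hc, show c + 1 = C.Cu - fuel by omega]
      convert ih using 1
      ring

/-! ## One u-cell of the derivative integrand `Φ(u) u sin(x'u)` -/

/-- `‖sin(x' z)‖ ≤ e^{x' R}` for real `x' ≥ 0` and `|Im z| ≤ R`. [folklore] -/
theorem norm_sin_ofReal_mul_le {x' R : ℝ} (hx : 0 ≤ x') {z : ℂ} (hz : |z.im| ≤ R) :
    ‖Complex.sin ((x' : ℂ) * z)‖ ≤ Real.exp (x' * R) := by
  refine (norm_sin_le_exp_abs_im _).trans (Real.exp_le_exp.2 ?_)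
  have : ((x' : ℂ) * z).im = x' * z.im := by simp [Complex.mul_im]
  rw [this, abs_mul, abs_of_nonneg hx]
  exact mul_le_mul_of_nonneg_left hz hx

/-- **GL error on one u-cell for the derivative integrand** (`uc = (2c+1)ρ`, `0 ≤ ρ < R ≤ 1/4`, `x' ≥ 0`):
`|∫_{−ρ}^{ρ} Φ_N(uc+s)(uc+s) sin(x'(uc+s)) ds − GLD_c| ≤ PhiMaj · (uc + R) · e^{x'R} · D(ρ,R)`. [folklore] -/
theorem cellD_gl_error {N : ℕ} {ρ R x' : ℝ} (hρ : 0 ≤ ρ) (hρR : ρ < R) (hR : R ≤ 1 / 4)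
    (hx : 0 ≤ x') (c : ℕ) :
    |(∫ s in (-ρ)..ρ, UniversalFactor.osaPhiN N ((2 * c + 1) * ρ + s) * ((2 * c + 1) * ρ + s) *
        Real.sin (x' * ((2 * c + 1) * ρ + s))) - cellGLD N ρ x' c| ≤
      UniversalFactor.osaPhiMajR N ((2 * c + 1) * ρ) R * (((2 * c + 1) * ρ) + R) * Real.exp (x' * R) *
        UniversalFactor.osaDefectR ρ R := by
  set uc : ℝ := (2 * c + 1) * ρ with huc
  have hR0 : 0 < R := lt_of_le_of_lt hρ hρR
  have huc0 : 0 ≤ uc := by rw [huc]; positivity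
  obtain ⟨hdiff, hreal, -⟩ := UniversalFactor.stub_phiPartialC N
  set f : ℂ → ℂ := fun w => UniversalFactor.osaPhiNC N w * w * Complex.sin ((x' : ℂ) * w) with hf
  have hfd : DifferentiableOn ℂ f (Metric.ball ((uc : ℝ) : ℂ) (R + 1)) := by
    refine Differentiable.differentiableOn ?_
    have h1 : Differentiable ℂ (UniversalFactor.osaPhiNC N) := by
      have : UniversalFactor.osaPhiNC N = fun w : ℂ => ∑ n ∈ Finset.range N,
          (2 * (Real.pi : ℂ) ^ 2 * ((n : ℂ) + 1) ^ 4 * Complex.exp (9 * w) -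
            3 * (Real.pi : ℂ) * ((n : ℂ) + 1) ^ 2 * Complex.exp (5 * w)) *
          Complex.exp (-((Real.pi : ℂ) * ((n : ℂ) + 1) ^ 2 * Complex.exp (4 * w))) := by
        funext w; rfl
      rw [this]; exact hdiff
    exact (h1.mul differentiable_id).mul (by fun_prop)
  have hM : ∀ z ∈ Metric.sphere ((uc : ℝ) : ℂ) R,
      ‖f z‖ ≤ UniversalFactor.osaPhiMajR N uc R * (uc + R) * Real.exp (x' * R) := by
    intro z hz
    have hz' : ‖z - uc‖ = R := by
      have h' := hz; rw [Metric.mem_sphere, dist_eq_norm] at h'; exact h'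
    have him : |z.im| ≤ R := by
      have := Complex.abs_im_le_norm (z - uc); simp at this; rw [← hz']; exact this
    have hzn : ‖z‖ ≤ uc + R := by
      have h1 : ‖z‖ ≤ ‖z - uc‖ + ‖((uc : ℝ) : ℂ)‖ := by
        have := norm_add_le (z - uc) ((uc : ℝ) : ℂ); simp at this ⊢; exact this
      rw [hz', Complex.norm_real, Real.norm_eq_abs, abs_of_nonneg huc0] at h1
      linarith
    rw [hf]; dsimp only
    rw [norm_mul, norm_mul]
    have hA := UniversalFactor.norm_osaPhiNC_le (N := N) hR0 hR hz
    have hA0 : 0 ≤ UniversalFactor.osaPhiMajR N uc R := (norm_nonneg _).trans hA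
    have hsn := norm_sin_ofReal_mul_le hx him
    have hucR : 0 ≤ uc + R := by linarith
    exact mul_le_mul (mul_le_mul hA hzn (norm_nonneg _) hA0) hsn (norm_nonneg _) (mul_nonneg hA0 hucR)
  have hu : ∀ j ∈ Finset.range 32, |ρ * UniversalFactor.osaNodeR j| ≤ ρ := by
    intro j hj
    rw [abs_mul, abs_of_nonneg hρ]
    have := UniversalFactor.abs_osaNodeR_le (Finset.mem_range.1 hj)
    nlinarith [abs_nonneg (UniversalFactor.osaNodeR j)]
  have hq := UniversalFactor.stub_quadH f ((uc : ℝ) : ℂ) R (R + 1) ρ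
    (UniversalFactor.osaPhiMajR N uc R * (uc + R) * Real.exp (x' * R)) hρ hρR (by linarith) hfd hM
    (Finset.range 32) (fun j => ρ * UniversalFactor.osaNodeR j) (fun j => ρ * UniversalFactor.osaWeightR j) hu 63
  -- identify the complex integral and node sum with the real ones
  have hfreal : ∀ s : ℝ, f ((uc : ℂ) + (s : ℂ)) =
      ((UniversalFactor.osaPhiN N (uc + s) * (uc + s) * Real.sin (x' * (uc + s)) : ℝ) : ℂ) := by
    intro s
    rw [hf]; dsimp only
    rw [show ((uc : ℂ) + (s : ℂ)) = ((uc + s : ℝ) : ℂ) by push_cast; rfl,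
      UniversalFactor.osaPhiNC_ofReal, show ((x' : ℂ) * ((uc + s : ℝ) : ℂ)) = ((x' * (uc + s) : ℝ) : ℂ) by push_cast; rfl,
      ← Complex.ofReal_sin]
    push_cast; rfl
  have hint : (∫ s in (-ρ)..ρ, f ((uc : ℂ) + (s : ℂ))) =
      ((∫ s in (-ρ)..ρ, UniversalFactor.osaPhiN N (uc + s) * (uc + s) * Real.sin (x' * (uc + s)) : ℝ) : ℂ) := by
    rw [← intervalIntegral.integral_ofReal]
    exact intervalIntegral.integral_congr fun s _ => hfreal s
  have hsum : ∑ j ∈ Finset.range 32, ((ρ * UniversalFactor.osaWeightR j : ℝ) : ℂ) *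
      f ((uc : ℂ) + ((ρ * UniversalFactor.osaNodeR j : ℝ) : ℂ)) =
      ((cellGLD N ρ x' c : ℝ) : ℂ) := by
    unfold cellGLD
    push_cast
    refine Finset.sum_congr rfl fun j _ => ?_
    rw [show ((ρ : ℂ) * (UniversalFactor.osaNodeR j : ℂ)) = ((ρ * UniversalFactor.osaNodeR j : ℝ) : ℂ) by push_cast; rfl,
      hfreal]
    simp only [huc]
    push_cast; ring
  rw [hint, hsum, ← Complex.ofReal_sub, Complex.norm_real, Real.norm_eq_abs] at hq
  refine hq.trans (le_of_eq ?_)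
  unfold UniversalFactor.osaDefectR
  simp only [show (63 : ℕ) + 1 = 64 from rfl]

/-- **Theta-tail error on one u-cell for the derivative integrand** (`uc − ρ ≥ 0`, `N ≥ 1`):
`|∫_{−ρ}^{ρ} (Φ − Φ_N)(uc+s)(uc+s) sin(x'(uc+s)) ds| ≤ 2ρ (uc + ρ) T_N(uc − ρ)`. [folklore] -/
theorem cellD_tail_error {N : ℕ} (hN : 1 ≤ N) {ρ uc x' : ℝ} (hρ : 0 ≤ ρ) (huc : 0 ≤ uc - ρ) :
    |∫ s in (-ρ)..ρ, (deBruijnPhi (uc + s) - UniversalFactor.osaPhiN N (uc + s)) * (uc + s) *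
        Real.sin (x' * (uc + s))| ≤ 2 * ρ * ((uc + ρ) * UniversalFactor.osaThetaT N (uc - ρ)) := by
  have h := intervalIntegral.norm_integral_le_of_norm_le_const (a := -ρ) (b := ρ)
    (C := (uc + ρ) * UniversalFactor.osaThetaT N (uc - ρ))
    (f := fun s => (deBruijnPhi (uc + s) - UniversalFactor.osaPhiN N (uc + s)) * (uc + s) *
      Real.sin (x' * (uc + s))) ?_
  · rw [Real.norm_eq_abs] at h
    refine h.trans (le_of_eq ?_)
    rw [show ρ - -ρ = 2 * ρ by ring, abs_of_nonneg (by linarith)]; ring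
  intro s hs
  have hs' : -ρ ≤ s ∧ s ≤ ρ := by
    rw [Set.uIoc_of_le (by linarith)] at hs; exact ⟨hs.1.le, hs.2⟩
  have hu0 : 0 ≤ uc + s := by linarith
  have hu1 : uc + s ≤ uc + ρ := by linarith
  obtain ⟨hlo, hhi⟩ := UniversalFactor.stub_phiTailN N (uc + s) hN hu0
  rw [Real.norm_eq_abs, abs_mul, abs_mul, abs_of_nonneg hu0]
  have hsin : |Real.sin (x' * (uc + s))| ≤ 1 := Real.abs_sin_le_one _
  have hT0 : 0 ≤ UniversalFactor.osaThetaT N (uc - ρ) := UniversalFactor.osaThetaT_nonneg _ _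
  have hT : |deBruijnPhi (uc + s) - UniversalFactor.osaPhiN N (uc + s)| ≤ UniversalFactor.osaThetaT N (uc - ρ) := by
    unfold UniversalFactor.osaPhiN
    rw [abs_of_nonneg hlo]
    refine hhi.trans ?_
    have := UniversalFactor.osaThetaT_antitone hN huc (show uc - ρ ≤ uc + s by linarith)
    unfold UniversalFactor.osaThetaT at this ⊢
    exact this
  calc |deBruijnPhi (uc + s) - UniversalFactor.osaPhiN N (uc + s)| * (uc + s) * |Real.sin (x' * (uc + s))|
      ≤ UniversalFactor.osaThetaT N (uc - ρ) * (uc + ρ) * 1 :=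
        mul_le_mul (mul_le_mul hT hu1 hu0 hT0) hsin (abs_nonneg _) (mul_nonneg hT0 (hu0.trans hu1))
    _ = _ := by ring

/-- The real derivative integrand `Φ(u) u sin(x'u)` is continuous on `[0, ∞)`. [folklore] -/
theorem continuousOn_phi_mul_id_mul_sin (x' : ℝ) :
    ContinuousOn (fun u : ℝ => deBruijnPhi u * u * Real.sin (x' * u)) (Ici 0) :=
  (continuousOn_deBruijnPhi_Ici.mul continuousOn_id).mul
    (by fun_prop : Continuous fun u : ℝ => Real.sin (x' * u)).continuousOn

/-- The real derivative integrand `Φ(u) u sin(x'u)` is integrable on `(0, ∞)`. [folklore] -/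
theorem integrableOn_phi_mul_id_mul_sin (x' : ℝ) :
    IntegrableOn (fun u : ℝ => deBruijnPhi u * u * Real.sin (x' * u)) (Ioi 0) := by
  have h1 : IntegrableOn (fun u : ℝ => deBruijnPhi u * u ^ 1) (Ioi 0) := integrableOn_deBruijnPhi_mul_pow 1
  have h2 : IntegrableOn (fun u : ℝ => Real.sin (x' * u) * (deBruijnPhi u * u ^ 1)) (Ioi 0) := by
    refine Integrable.bdd_mul (c := 1) h1 ?_ ?_
    · exact (by fun_prop : Continuous fun u : ℝ => Real.sin (x' * u)).aestronglyMeasurable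
    · exact Filter.Eventually.of_forall fun u => by
        rw [Real.norm_eq_abs]; exact Real.abs_sin_le_one _
  refine h2.congr_fun (fun u _ => ?_) measurableSet_Ioi
  simp only [pow_one]; ring

/-- **Total error on one u-cell for the derivative integrand** (`c < Cu`, `U = 2 Cu ρ`):
`|∫_{2cρ}^{2(c+1)ρ} Φ(u) u sin(x'u) du − GLD_c| ≤ PhiMaj_c (U + R) e^{x'R} D + 2ρ U T_N(2cρ)`. [folklore] -/
theorem cellD_error {N : ℕ} (hN : 1 ≤ N) {ρ R x' : ℝ} (hρ : 0 ≤ ρ) (hρR : ρ < R)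
    (hR : R ≤ 1 / 4) (hx : 0 ≤ x') {Cu : ℕ} {c : ℕ} (hc : c < Cu) :
    |(∫ u in (2 * c * ρ)..(2 * (c + 1) * ρ), deBruijnPhi u * u * Real.sin (x' * u)) - cellGLD N ρ x' c| ≤
      UniversalFactor.osaPhiMajR N ((2 * c + 1) * ρ) R * ((2 * Cu * ρ + R) * Real.exp (x' * R) *
          UniversalFactor.osaDefectR ρ R) +
        2 * ρ * (2 * Cu * ρ) * UniversalFactor.osaThetaT N (2 * c * ρ) := by
  set uc : ℝ := (2 * c + 1) * ρ with huc
  have hc0 : (0:ℝ) ≤ c := Nat.cast_nonneg c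
  have hc1 : (c : ℝ) + 1 ≤ Cu := by exact_mod_cast hc
  have hucρ : 0 ≤ uc - ρ := by rw [huc]; nlinarith
  have hucU : uc + ρ ≤ 2 * Cu * ρ := by rw [huc]; nlinarith
  have hucU' : uc + R ≤ 2 * Cu * ρ + R := by linarith
  have hR0 : 0 < R := lt_of_le_of_lt hρ hρR
  -- shift to the symmetric cell
  have hshift : (∫ u in (2 * c * ρ)..(2 * (c + 1) * ρ), deBruijnPhi u * u * Real.sin (x' * u)) =
      ∫ s in (-ρ)..ρ, deBruijnPhi (uc + s) * (uc + s) * Real.sin (x' * (uc + s)) := by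
    have h := intervalIntegral.integral_comp_add_left (a := -ρ) (b := ρ)
      (fun u => deBruijnPhi u * u * Real.sin (x' * u)) uc
    rw [h]; congr 1 <;> rw [huc] <;> ring
  rw [hshift]
  have hcontA : Continuous fun s : ℝ => UniversalFactor.osaPhiN N (uc + s) * (uc + s) * Real.sin (x' * (uc + s)) := by
    unfold UniversalFactor.osaPhiN
    refine Continuous.mul (Continuous.mul (continuous_finsetSum _ fun n _ => ?_) (by fun_prop)) (by fun_prop)
    exact (continuous_deBruijnPhiSummand n).comp (by fun_prop)
  have hcontG : ContinuousOn (fun s : ℝ => deBruijnPhi (uc + s) * (uc + s) * Real.sin (x' * (uc + s))) (uIcc (-ρ) ρ) := by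
    have h1 : ContinuousOn (fun s : ℝ => deBruijnPhi (uc + s)) (uIcc (-ρ) ρ) := by
      refine continuousOn_deBruijnPhi_Ici.comp (by fun_prop : Continuous fun s : ℝ => uc + s).continuousOn ?_
      intro s hs
      rw [uIcc_of_le (by linarith)] at hs
      simp only [mem_Ici]; linarith [hs.1]
    exact (h1.mul (by fun_prop : Continuous fun s : ℝ => uc + s).continuousOn).mul
      (by fun_prop : Continuous fun s : ℝ => Real.sin (x' * (uc + s))).continuousOn
  have hiA : IntervalIntegrable (fun s : ℝ => UniversalFactor.osaPhiN N (uc + s) * (uc + s) * Real.sin (x' * (uc + s)))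
      volume (-ρ) ρ := hcontA.intervalIntegrable _ _
  have hiG : IntervalIntegrable (fun s : ℝ => deBruijnPhi (uc + s) * (uc + s) * Real.sin (x' * (uc + s))) volume (-ρ) ρ :=
    hcontG.intervalIntegrable
  have hiB : IntervalIntegrable
      (fun s : ℝ => (deBruijnPhi (uc + s) - UniversalFactor.osaPhiN N (uc + s)) * (uc + s) * Real.sin (x' * (uc + s)))
      volume (-ρ) ρ :=
    (hiG.sub hiA).congr fun s _ => by show _ - _ = _; ring
  have hsplit : (∫ s in (-ρ)..ρ, deBruijnPhi (uc + s) * (uc + s) * Real.sin (x' * (uc + s))) =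
      (∫ s in (-ρ)..ρ, UniversalFactor.osaPhiN N (uc + s) * (uc + s) * Real.sin (x' * (uc + s))) +
        ∫ s in (-ρ)..ρ, (deBruijnPhi (uc + s) - UniversalFactor.osaPhiN N (uc + s)) * (uc + s) *
          Real.sin (x' * (uc + s)) := by
    rw [← intervalIntegral.integral_add hiA hiB]
    exact intervalIntegral.integral_congr fun s _ => by ring
  rw [hsplit]
  have h1 := cellD_gl_error (N := N) hρ hρR hR hx c
  have h2 := cellD_tail_error hN (x' := x') hρ hucρ
  rw [← huc] at h1
  have e : uc - ρ = 2 * c * ρ := by rw [huc]; ring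
  rw [e] at h2
  have hPM0 : 0 ≤ UniversalFactor.osaPhiMajR N uc R := UniversalFactor.osaPhiMajR_nonneg _ _ _
  have hD0 : 0 ≤ UniversalFactor.osaDefectR ρ R := UniversalFactor.osaDefectR_nonneg hρ hρR
  have hT0 : 0 ≤ UniversalFactor.osaThetaT N (2 * c * ρ) := UniversalFactor.osaThetaT_nonneg _ _
  have hE0 : 0 ≤ Real.exp (x' * R) := (Real.exp_pos _).le
  have h1' : UniversalFactor.osaPhiMajR N uc R * (uc + R) * Real.exp (x' * R) * UniversalFactor.osaDefectR ρ R ≤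
      UniversalFactor.osaPhiMajR N uc R * ((2 * Cu * ρ + R) * Real.exp (x' * R) * UniversalFactor.osaDefectR ρ R) := by
    rw [show UniversalFactor.osaPhiMajR N uc R * (uc + R) * Real.exp (x' * R) * UniversalFactor.osaDefectR ρ R =
      UniversalFactor.osaPhiMajR N uc R * ((uc + R) * Real.exp (x' * R) * UniversalFactor.osaDefectR ρ R) by ring]
    refine mul_le_mul_of_nonneg_left ?_ hPM0
    exact mul_le_mul_of_nonneg_right (mul_le_mul_of_nonneg_right hucU' hE0) hD0
  have h2' : 2 * ρ * ((uc + ρ) * UniversalFactor.osaThetaT N (2 * c * ρ)) ≤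
      2 * ρ * (2 * Cu * ρ) * UniversalFactor.osaThetaT N (2 * c * ρ) := by
    rw [show 2 * ρ * (2 * Cu * ρ) * UniversalFactor.osaThetaT N (2 * c * ρ) =
      2 * ρ * ((2 * Cu * ρ) * UniversalFactor.osaThetaT N (2 * c * ρ)) by ring]
    exact mul_le_mul_of_nonneg_left (mul_le_mul_of_nonneg_right hucU hT0) (by positivity)
  calc |(∫ s in (-ρ)..ρ, UniversalFactor.osaPhiN N (uc + s) * (uc + s) * Real.sin (x' * (uc + s))) +
        (∫ s in (-ρ)..ρ, (deBruijnPhi (uc + s) - UniversalFactor.osaPhiN N (uc + s)) * (uc + s) *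
          Real.sin (x' * (uc + s))) - cellGLD N ρ x' c|
      = |((∫ s in (-ρ)..ρ, UniversalFactor.osaPhiN N (uc + s) * (uc + s) * Real.sin (x' * (uc + s))) -
          cellGLD N ρ x' c) +
          ∫ s in (-ρ)..ρ, (deBruijnPhi (uc + s) - UniversalFactor.osaPhiN N (uc + s)) * (uc + s) *
            Real.sin (x' * (uc + s))| := by congr 1; ring
    _ ≤ _ := (abs_add_le _ _).trans (add_le_add (h1.trans h1') (h2.trans h2'))

end Summit.RiemannHypothesis.RiemannHypothesis.Theorems.Splittings.LinearRayOnePoint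

end
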